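import Mathlib
import Summits.Ventures.HodgeRepro.Tier4.Common.SettingOfData
import Summits.Ventures.HodgeRepro.Tier4.Line1.RtfGeometric
import Summits.Ventures.HodgeRepro.Tier4.Line4.TwoTorusCut
import Summits.Ventures.HodgeRepro.Tier4.Line4.TwoTorusSpectral

/-!
# Tier4/Line4/GeometricBridge — W5's object on the DEFINED objects WITH COMPACTNESS DISPLAYED: `RTFData.Jc f` IS
L1's distribution `J(f)` on typer-2's `Setting.ofAdelicData`, hence (L1-p2's landed `rtf_geometric`) the FINITE sum of
the rational double-coset orbital terms, and «one contributing orbit with a non-zero orbital term» ⇒ `Jc f ≠ 0` ⇒ W3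
(with W4 on `Jc`)

Blind re-derivation cell `pub-hodge-repro`, Tier 4 «prove the step» (README §9–§10), seat t4-L4-p2 (gen 2; lead g385
cut S13064 (5): W4 / W5).  Tree path `lean/Summits/Ventures/HodgeRepro/Tier4/Line4/GeometricBridge.lean`.  Imports
typer-2's `Common/SettingOfData` (p675640: `Setting.ofAdelicData` — an `RTF.Setting (GA W)` from an `RTFData W`, a Haar
`μ` and the DISPLAYED cocompactness data `DG` / `compG` / `compT` / `compT'`; discreteness and closedness of `G(k)` are
L1-p5's theorems inside it), L1-p2's `Line1/RtfGeometric` (p663290: `rtf_geometric : S.J χ χ' f = ∑ᶠ o, S.orbital χ χ'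
o f` for test functions, NO convergence hypothesis — the finiteness of the contributing double cosets is PROVED there
from the compactness data; `finite_support_closure`; the two helper lemmas), and this line's `TwoTorusCut` /
`TwoTorusSpectral`.

WHAT IS PROVED.  (1) `kernel_eq_setting_kernel` (rfl): the two kernels coincide.  (2) `Jc_eq_J`: `R.Jc f = S.J R.chi
R.chi' f` for a test function `f` and continuous characters — the `periodLin`-defined double period of `AdelicRTF` is
the iterated set integral of L1 (the integrability of both integrands comes from the finiteness of the kernel sum on
`closure D_T × closure D_{T′}`, as in L1-p2's step (iv)).  (3) `Jc_eq_finsum_orbital`: **the geometric side of W5's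
object, by name** — `R.Jc f = ∑ᶠ o : T(k)\G(k)/T′(k), S.orbital R.chi R.chi' o f` (L1.1 consumed; unitarity of the
characters displayed as `hu`, `hu'`, exactly L1's `IsCharacter`).  (4) `Jc_eq_orbital_of_isolated`: with ONE
contributing double coset (`S.geoSupport f = {o₀}`) `R.Jc f = S.orbital R.chi R.chi' o₀ f`.  (5)
`exists_admissible_mixed_of_isolated_orbital`: W3 from W4 on `Jc` + isolation + `orbital o₀ f ≠ 0`.

WHAT IS NOT.  The cocompactness data (`compG` = BHC for `G(k)\G(𝔸)`, `compT`/`compT'` = Fujisaki for the tori) are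
DISPLAYED, not proved; the isolation `geoSupport f = {o₀}` (the arithmetic of the two-torus double cosets at deep level)
and the non-vanishing of one orbital term (a local computation with the weight-3 archimedean test function) are
DISPLAYED; W4 (the spectral expansion of `Jc f` into Hecke eigen-terms with Riesz vectors) is DISPLAYED.  Nothing on
the wall is closed.  HC_CM is NOT proved by anyone in this repository.
-/

set_option autoImplicit false

noncomputable section

namespace Summit.Ventures.HodgeRepro.Tier4.Line4

open Summit.Ventures.HodgeRepro.Tier4.Common Summit.Ventures.HodgeRepro.Tier4.Line1 MeasureTheory NumberField
  Topology

section Bridge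

variable {k : Type} [Field k] [NumberField k] (W : PlaneData k) [MeasurableSpace (GA W)] [BorelSpace (GA W)]
  (R : RTFData W) (μ : Measure (GA W)) [μ.IsHaarMeasure] [R.μT.IsHaarMeasure] [R.μT'.IsHaarMeasure]
  (DG : Set (GA W)) (fdG : IsFundamentalDomain (rationalPoints W) DG μ) (compG : IsCompact (closure DG))
  (compT : IsCompact (closure R.DT)) (compT' : IsCompact (closure R.DT'))

/-- The kernel of `AdelicRTF` is the kernel of the setting (definitionally). -/
theorem kernel_eq_setting_kernel (f : GA W → ℂ) (x y : GA W) :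
    kernel W f x y = (Setting.ofAdelicData W R μ DG fdG compG compT compT').kernel f x y := rfl

/-- `R.chi` is a character of the setting (continuity and unitarity displayed). -/
theorem isCharacter_chi (hc : Continuous R.chi) (hu : ∀ a, ‖R.chi a‖ = 1) :
    (Setting.ofAdelicData W R μ DG fdG compG compT compT').IsCharacter R.chi :=
  ⟨hc, R.chi_mul, hu, fun a ha => R.chi_rational a (Subgroup.mem_subgroupOf.mp ha)⟩

/-- `R.chi'` is a character of the setting. -/
theorem isCharacter'_chi' (hc' : Continuous R.chi') (hu' : ∀ a, ‖R.chi' a‖ = 1) :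
    (Setting.ofAdelicData W R μ DG fdG compG compT compT').IsCharacter' R.chi' :=
  ⟨hc', R.chi'_mul, hu', fun a ha => R.chi'_rational a (Subgroup.mem_subgroupOf.mp ha)⟩

/-- **`Jc = J`**: the `periodLin`-defined double period of `AdelicRTF` is L1's iterated set integral on the setting, for
a test function `f` and continuous characters.  Both integrands are integrable because on `closure D_T × closure D_{T′}`
the kernel is a FINITE sum of continuous functions (`finite_support_closure`), the inner integral of that model is
continuous in `t` (tube lemma, `continuous_setIntegral_of_continuous_uncurry`), and Haar measures are finite on
compacts. -/
theorem Jc_eq_J (hc : Continuous R.chi) (hc' : Continuous R.chi') {f : GA W → ℂ} (hf : IsTestFn W f) :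
    R.Jc f = (Setting.ofAdelicData W R μ DG fdG compG compT compT').J R.chi R.chi' f := by
  classical
  set S := Setting.ofAdelicData W R μ DG fdG compG compT compT' with hS
  have hf' : RTF.IsTest f := ⟨hf.1, hf.2⟩
  haveI : IsFiniteMeasureOnCompacts R.μT := (inferInstance : R.μT.IsHaarMeasure).toIsFiniteMeasureOnCompacts
  haveI : IsFiniteMeasureOnCompacts R.μT' := (inferInstance : R.μT'.IsHaarMeasure).toIsFiniteMeasureOnCompacts
  -- the finite set of contributing rational points on the closures of the domains
  obtain ⟨Γ, hΓ⟩ : ∃ Γ : Finset S.Gk, ∀ γ : S.Gk, γ ∉ Γ → ∀ t ∈ closure S.DT,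
      ∀ t' ∈ closure S.DT', f ((t : GA W)⁻¹ * γ * t') = 0 := by
    refine ⟨(S.finite_support_closure hf').toFinset, fun γ hγ t ht t' ht' => ?_⟩
    by_contra hne
    exact hγ ((S.finite_support_closure hf').mem_toFinset.2 ⟨t, ht, t', ht', hne⟩)
  have hker : ∀ t ∈ closure S.DT, ∀ t' ∈ closure S.DT',
      kernel W f t t' = ∑ γ ∈ Γ, f ((t : GA W)⁻¹ * γ * t') := fun t ht t' ht' =>
    tsum_eq_sum (fun γ hγ => hΓ γ hγ t ht t' ht')
  -- the continuous model of the inner integrand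
  have hcont : ∀ γ : S.Gk, Continuous fun p : S.T × S.T' => f ((p.1 : GA W)⁻¹ * γ * p.2) := fun γ =>
    hf.1.comp (((continuous_subtype_val.comp continuous_fst).inv.mul continuous_const).mul
      (continuous_subtype_val.comp continuous_snd))
  have hF : Continuous (Function.uncurry fun (t : S.T) (t' : S.T') =>
      R.chi'conj t' * ∑ γ ∈ Γ, f ((t : GA W)⁻¹ * γ * t')) := by
    apply Continuous.mul
    · exact (continuous_star : Continuous (starRingEnd ℂ)).comp (hc'.comp continuous_snd)
    · exact continuous_finsetSum _ (fun γ _ => hcont γ)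
  -- inner integrability on `D_{T′}` for `t ∈ closure D_T`
  have hinner : ∀ t ∈ closure S.DT,
      Integrable (fun t' : torusT' W => R.chi'conj t' * kernel W f (t : GA W) (t' : GA W)) (R.μT'.restrict R.DT') := by
    intro t ht
    have hcm : Continuous fun t' : S.T' => R.chi'conj t' * ∑ γ ∈ Γ, f ((t : GA W)⁻¹ * γ * t') :=
      hF.uncurry_left t
    refine ((hcm.continuousOn.integrableOn_compact' compT' isClosed_closure.measurableSet).congr_fun
      ?_ isClosed_closure.measurableSet).mono_set subset_closure
    intro t' ht'
    simp only [hker t ht t' ht']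
  -- the inner period is the inner integral on `closure D_T`, and agrees there with the continuous model
  have hinnerEq : ∀ t ∈ closure S.DT,
      R.periodT'conj (fun t' : torusT' W => kernel W f (t : GA W) (t' : GA W)) =
        ∫ t' in R.DT', R.chi'conj t' * ∑ γ ∈ Γ, f ((t : GA W)⁻¹ * γ * t') ∂(R.μT') := by
    intro t ht
    unfold RTFData.periodT'conj
    rw [periodLin_eq_integral W R.μT' R.DT' R.chi'conj (hinner t ht)]
    apply RTF.Geometric.setIntegral_congr_of_eqOn_closure
    intro t' ht'
    simp only [hker t ht t' ht']
  -- the continuous model of the outer integrand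
  have hG : Continuous fun t : S.T => R.chi t *
      ∫ t' in R.DT', R.chi'conj t' * ∑ γ ∈ Γ, f ((t : GA W)⁻¹ * γ * t') ∂(R.μT') :=
    hc.mul (RTF.Geometric.continuous_setIntegral_of_continuous_uncurry compT' hF)
  have houter : Integrable (fun t : torusT W => R.chi t *
      R.periodT'conj (fun t' : torusT' W => kernel W f (t : GA W) (t' : GA W))) (R.μT.restrict R.DT) := by
    refine ((hG.continuousOn.integrableOn_compact' compT isClosed_closure.measurableSet).congr_fun
      ?_ isClosed_closure.measurableSet).mono_set subset_closure
    intro t ht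
    simp only [hinnerEq t ht]
  -- assemble
  unfold RTFData.Jc RTFData.periodT
  rw [periodLin_eq_integral W R.μT R.DT R.chi houter]
  show _ = ∫ t in S.DT, ∫ t' in S.DT', S.kernel f t t' * R.chi t * starRingEnd ℂ (R.chi' t') ∂S.μT' ∂S.μT
  apply RTF.Geometric.setIntegral_congr_of_eqOn_closure
  intro t ht
  beta_reduce
  rw [hinnerEq t ht, ← integral_const_mul]
  apply RTF.Geometric.setIntegral_congr_of_eqOn_closure
  intro t' ht'
  beta_reduce
  show R.chi t * (R.chi'conj t' * ∑ γ ∈ Γ, f ((t : GA W)⁻¹ * γ * t')) =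
    kernel W f t t' * R.chi t * starRingEnd ℂ (R.chi' t')
  rw [hker t ht t' ht']
  unfold RTFData.chi'conj
  ring

/-- **The geometric side of W5's object, BY NAME** (L1-p2's `rtf_geometric` on typer-2's setting): the DEFINED double
period `Jc f` of a test function is the FINITE sum over the rational double cosets `T(k)\G(k)/T′(k)` of the orbital
terms, with the cocompactness data, the continuity and the unitarity of the characters DISPLAYED. -/
theorem Jc_eq_finsum_orbital (hc : Continuous R.chi) (hu : ∀ a, ‖R.chi a‖ = 1)
    (hc' : Continuous R.chi') (hu' : ∀ a, ‖R.chi' a‖ = 1) {f : GA W → ℂ} (hf : IsTestFn W f) :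
    R.Jc f = ∑ᶠ o, (Setting.ofAdelicData W R μ DG fdG compG compT compT').orbital R.chi R.chi' o f := by
  rw [Jc_eq_J W R μ DG fdG compG compT compT' hc hc' hf]
  exact (Setting.ofAdelicData W R μ DG fdG compG compT compT').rtf_geometric
    (isCharacter_chi W R μ DG fdG compG compT compT' hc hu) (isCharacter'_chi' W R μ DG fdG compG compT compT' hc' hu')
    ⟨hf.1, hf.2⟩

/-- **W5's shape «only one double coset contributes»**: if the geometric support of `f` is the single double coset
`o₀`, the double period IS its orbital term (`finsum_eq_single` + `orbital_eq_zero_of_not_mem`). -/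
theorem Jc_eq_orbital_of_isolated (hc : Continuous R.chi) (hu : ∀ a, ‖R.chi a‖ = 1)
    (hc' : Continuous R.chi') (hu' : ∀ a, ‖R.chi' a‖ = 1) {f : GA W → ℂ} (hf : IsTestFn W f)
    {o₀ : (Setting.ofAdelicData W R μ DG fdG compG compT compT').Orbit}
    (hiso : (Setting.ofAdelicData W R μ DG fdG compG compT compT').geoSupport f = {o₀}) :
    R.Jc f = (Setting.ofAdelicData W R μ DG fdG compG compT compT').orbital R.chi R.chi' o₀ f := by
  rw [Jc_eq_finsum_orbital W R μ DG fdG compG compT compT' hc hu hc' hu' hf]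
  apply finsum_eq_single
  intro o ho
  apply (Setting.ofAdelicData W R μ DG fdG compG compT compT').orbital_eq_zero_of_not_mem
  rw [hiso]
  simpa using ho

/-- **W3 from W4 on `Jc` + W5 in its ISOLATED-ORBIT form**: a spectral expansion of `Jc f` over admissible subspaces
(W4, displayed), one contributing rational double coset `o₀` (displayed: the deep-level isolation) and a non-zero
orbital term there (displayed: the local non-vanishing) give an admissible `V` with a non-zero mixed period. -/
theorem exists_admissible_mixed_of_isolated_orbital (hc : Continuous R.chi) (hu : ∀ a, ‖R.chi a‖ = 1)
    (hc' : Continuous R.chi') (hu' : ∀ a, ‖R.chi' a‖ = 1) {f : GA W → ℂ} (hf : IsTestFn W f)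
    {n : ℕ} (V : Fin n → Submodule ℂ (GA W → ℂ)) (lam : Fin n → ℂ) (v' : Fin n → (GA W → ℂ))
    (q : QuadData k) (g g' : Matrix (Fin 4) (Fin 4) k) (w₀ : InfinitePlace k) (eP eM eP' eM' : InfinitePlace k → ℤ)
    (hadm : ∀ i, IsAdmissible W q g g' w₀ eP eM eP' eM' (V i))
    (hS : IsTwoTorusSpectralExpansion W R μ f (R.Jc f) V lam v')
    {o₀ : (Setting.ofAdelicData W R μ DG fdG compG compT compT').Orbit}
    (hiso : (Setting.ofAdelicData W R μ DG fdG compG compT compT').geoSupport f = {o₀})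
    (hne : (Setting.ofAdelicData W R μ DG fdG compG compT compT').orbital R.chi R.chi' o₀ f ≠ 0) :
    ∃ V₀ : Submodule ℂ (GA W → ℂ), IsAdmissible W q g g' w₀ eP eM eP' eM' V₀ ∧ HasNonzeroMixedPeriod W R V₀ := by
  refine exists_admissible_mixed_of_spectral W R μ f (R.Jc f) V lam v' q g g' w₀ eP eM eP' eM' hadm hS ?_
  rw [Jc_eq_orbital_of_isolated W R μ DG fdG compG compT compT' hc hu hc' hu' hf hiso]
  exact hne

end Bridge

end Summit.Ventures.HodgeRepro.Tier4.Line4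

end
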